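import Summits.QuantumFields.YangMills.Theorems.BalabanLadderNTReferenceTorusTemperedCumulant
import Summits.QuantumFields.YangMills.Theorems.BalabanLadderNTReferenceTorusExplicit
import HarnessLib

/-!
# Seam `UVSeamRec` (stmt-QuantumFields-20043), conjunct 3 of `stub_floorsEngine` in TEMPERED currency: the
# three-point floor on every torus from ONE torus per coupling, with ceilings only on GOOD exteriors + rarity

Helper file (`--supports stmt-QuantumFields-20043`; owner R78: THREE-POINT CONJUNCT supplier; lead ym-spine-20043-p1 g7
09:44Z located suggestion) of the fleet lead prover of crux `NT` (unit `ym-spine-19353-p1`, g5); route-independent.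
CLAUSE SERVED: conjunct 3 (the `|Q3(f,g,h)| ≥ ε` floor, compactly supported pairwise-disjoint witnesses) of the
registered v4-F `stub_floorsEngine`.  The tempered `∀ L` statement on top of `…NTReferenceTorusTemperedCumulant.lean`
(p526192): per coupling `β` the engine names the transfer cube `P_β = [−RP(β), RP(β)]⁴`, `RP(β) = ⌈(σ+κ)/aβ⌉₊+1`, a
measurable set `Good β` of its exteriors with rarity `μ_{β,L}(lift⁻¹(Good β)ᶜ) ≤ δ(β)` on EVERY torus `2L+1` with
`aβ·L ≥ σ+κ+1`, E1/E2/E3-osc for `P_β` ON `Good β`, and the three-point floor on ONE torus `2L₀(β)+1` with the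
TEMPERED per-triple margin `M₃ᵗ` (the bound of `triple_transfer_torus_tempered` at `α = aβ`, `δ = δ(β)`, summed
against `|f||g||h|`); it gets `|Q3_{β,L}(f,g,h)| ≥ ε` on every torus `aβ·L ≥ σ+κ+1`, eventually in `β`
(`q3_floor_of_torusReference_tempered`), hence conjunct 3 verbatim (`threePointConjunct_of_torusTempered`).  General
`(G, r, a)`; no `SU(2)`-specific step; `Good = univ`, `δ = 0` recovers g4's `q3_floor_of_torusReference` restricted to
the transfer cube.  (The ∀-exterior form of these ceilings is likely FALSE — lead p518535
`not_e1osc_of_densPenetration`, seam-s2 CEILINGS note §2–3 — which is why the supply is re-run tempered.)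

Refs: lead line fleet INBOX 2026-08-27T09:44:53Z; g4 `…NTReferenceTorusExplicit.lean` (`q3_floor_of_torusReference`).
-/

set_option autoImplicit false

noncomputable section

open scoped SchwartzMap
open MeasureTheory Filter Topology
open Literature.MathematicalPhysics.QuantumFieldTheory Literature.MathematicalPhysics.QuantumLattice
open Literature.Probability.LatticeModels
open Summit.QuantumFields.YangMills.Cruxes.OSLegsFromFemtoAndGap.DlrCollarTransfer

namespace Summit.QuantumFields.YangMills.Cruxes.NT.Reference

section Torus

variable (G : Type) [Group G] [TopologicalSpace G] [IsTopologicalGroup G] [CompactSpace G]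
  [MeasurableSpace G] [BorelSpace G] (r : LatticeRep G)

/-- **TEMPERED three-point floor on every torus from ONE torus per coupling** (module docstring; explicit witnesses).
[folklore] -/
theorem q3_floor_of_torusReference_tempered (a : ℝ → ℝ) (ha₀ : ∀ β, 0 < a β) (ha : Tendsto a atTop (𝓝 0))
    {C₁ C₂ C₃ σ κ M : ℝ} (hC₁ : 0 ≤ C₁) (hC₂ : 0 ≤ C₂) (hC₃ : 0 ≤ C₃) (hσ : 0 < σ) (hκ : 0 < κ)
    (hM : ∀ (x : Fin 4 → ℤ) (U : LGConfig 4 G), |dens G r x U| ≤ M)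
    (RP : ℝ → ℕ) (hRP : ∀ β, RP β = ⌈(σ + κ) / a β⌉₊ + 1)
    (Good : ℝ → Set (LGConfig 4 G)) (hGood : ∀ β, MeasurableSet (Good β)) (δ : ℝ → ℝ)
    (hE1 : ∃ β₁ : ℝ, ∀ β : ℝ, β₁ ≤ β → ∀ ζ ∈ Good β, ∀ ζ' ∈ Good β, ∀ x : Fin 4 → ℤ,
      1 ≤ depth (fun _ => -(RP β : ℤ)) (2 * RP β + 1) x →
        |kerE G r β (fun _ => -(RP β : ℤ)) (2 * RP β + 1) ζ (dens G r x) -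
          kerE G r β (fun _ => -(RP β : ℤ)) (2 * RP β + 1) ζ' (dens G r x)| ≤
          C₁ / (depth (fun _ => -(RP β : ℤ)) (2 * RP β + 1) x : ℝ) ^ 4)
    (hE2 : ∃ β₂ : ℝ, ∀ β : ℝ, β₂ ≤ β → ∀ ζ ∈ Good β, ∀ ζ' ∈ Good β, ∀ x y : Fin 4 → ℤ,
      1 ≤ depth (fun _ => -(RP β : ℤ)) (2 * RP β + 1) x → 1 ≤ depth (fun _ => -(RP β : ℤ)) (2 * RP β + 1) y →
        |kerCov G r β (fun _ => -(RP β : ℤ)) (2 * RP β + 1) ζ (dens G r x) (dens G r y) -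
          kerCov G r β (fun _ => -(RP β : ℤ)) (2 * RP β + 1) ζ' (dens G r x) (dens G r y)| ≤
          C₂ / ((min (depth (fun _ => -(RP β : ℤ)) (2 * RP β + 1) x)
            (depth (fun _ => -(RP β : ℤ)) (2 * RP β + 1) y) : ℕ) : ℝ) ^ 4 / (1 + ‖siteToE (y - x)‖) ^ 4)
    (hE3 : ∃ β₃ : ℝ, ∀ β : ℝ, β₃ ≤ β → ∀ ζ ∈ Good β, ∀ ζ' ∈ Good β, ∀ x y z : Fin 4 → ℤ,
      1 ≤ depth (fun _ => -(RP β : ℤ)) (2 * RP β + 1) x → 1 ≤ depth (fun _ => -(RP β : ℤ)) (2 * RP β + 1) y →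
      1 ≤ depth (fun _ => -(RP β : ℤ)) (2 * RP β + 1) z →
        |kerK3 G r β (fun _ => -(RP β : ℤ)) (2 * RP β + 1) ζ x y z -
          kerK3 G r β (fun _ => -(RP β : ℤ)) (2 * RP β + 1) ζ' x y z| ≤
          C₃ / ((min (min (depth (fun _ => -(RP β : ℤ)) (2 * RP β + 1) x)
            (depth (fun _ => -(RP β : ℤ)) (2 * RP β + 1) y)) (depth (fun _ => -(RP β : ℤ)) (2 * RP β + 1) z) : ℕ) : ℝ) ^ 4 /
            (1 + min (min ‖siteToE (y - x)‖ ‖siteToE (z - y)‖) ‖siteToE (z - x)‖) ^ 8)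
    (hrare : ∃ βr : ℝ, ∀ β : ℝ, βr ≤ β → ∀ L : ℕ, σ + κ + 1 ≤ a β * L →
      (wilsonMeasure (d := 4) (L := 2 * L + 1) r.ρ β).real ((torusLift (2 * L + 1)) ⁻¹' Good β)ᶜ ≤ δ β)
    (f g h : 𝓢(EuclideanSpace ℝ (Fin 4), ℝ)) (ε β₅ : ℝ) (L₀ : ℝ → ℕ)
    (hfσ : tsupport (f : EuclideanSpace ℝ (Fin 4) → ℝ) ⊆ Metric.closedBall 0 σ)
    (hgσ : tsupport (g : EuclideanSpace ℝ (Fin 4) → ℝ) ⊆ Metric.closedBall 0 σ)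
    (hhσ : tsupport (h : EuclideanSpace ℝ (Fin 4) → ℝ) ⊆ Metric.closedBall 0 σ)
    (HR : ∀ β : ℝ, β₅ ≤ β → σ + κ + 1 ≤ a β * L₀ β ∧
      ε + ∑ x ∈ box 4 (L₀ β), ∑ y ∈ box 4 (L₀ β), ∑ z ∈ box 4 (L₀ β),
          |f (a β • siteToE x)| * |g (a β • siteToE y)| * |h (a β • siteToE z)| *
            (2 * (((C₁ * (a β / κ) ^ 4 + 2 * M * δ β) *
                      (C₂ * (a β / κ) ^ 4 / (1 + ‖siteToE (z - y)‖) ^ 4 + 2 * (2 * M * M) * δ β)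
                  + (C₁ * (a β / κ) ^ 4 + 2 * M * δ β) *
                      (C₂ * (a β / κ) ^ 4 / (1 + ‖siteToE (z - x)‖) ^ 4 + 2 * (2 * M * M) * δ β)
                  + (C₁ * (a β / κ) ^ 4 + 2 * M * δ β) *
                      (C₂ * (a β / κ) ^ 4 / (1 + ‖siteToE (y - x)‖) ^ 4 + 2 * (2 * M * M) * δ β)
                  + (C₁ * (a β / κ) ^ 4 + 2 * M * δ β) * (C₁ * (a β / κ) ^ 4 + 2 * M * δ β) *
                      (C₁ * (a β / κ) ^ 4 + 2 * M * δ β))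
                + (4 * (M * (2 * M * M) + M * (2 * M * M) + M * (2 * M * M)) + 8 * M * M * M) * δ β)
              + (C₃ * (a β / κ) ^ 4 / (1 + min (min ‖siteToE (y - x)‖ ‖siteToE (z - y)‖) ‖siteToE (z - x)‖) ^ 8
                  + 2 * (6 * (M * M * M)) * (δ β + δ β))) ≤
        |Q3 G r β (L₀ β) (a β) f g h|) :
    ∃ β₅' : ℝ, ∀ β : ℝ, β₅' ≤ β → ∀ L : ℕ, σ + κ + 1 ≤ a β * L → ε ≤ |Q3 G r β L (a β) f g h| := by
  obtain ⟨β₁, H1⟩ := hE1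
  obtain ⟨β₂, H2⟩ := hE2
  obtain ⟨β₃, H3⟩ := hE3
  obtain ⟨βr, Hr⟩ := hrare
  have hδ' : 0 < min (1 / 4 : ℝ) (((2 * (σ + κ) + 5) - 2 * (σ + κ)) / 5) := lt_min (by norm_num) (by linarith)
  obtain ⟨βa, Ha⟩ := eventually_le_of_tendsto ha hδ'
  refine ⟨max (max β₅ βa) (max (max β₁ β₂) (max β₃ βr)), fun β hβ L hL => ?_⟩
  have hβ₅ : β₅ ≤ β := le_trans (le_max_left _ _) (le_trans (le_max_left _ _) hβ)
  have hβa : βa ≤ β := le_trans (le_max_right _ _) (le_trans (le_max_left _ _) hβ)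
  have hβ₁ : β₁ ≤ β := le_trans (le_max_left _ _) (le_trans (le_max_left _ _) (le_trans (le_max_right _ _) hβ))
  have hβ₂ : β₂ ≤ β := le_trans (le_max_right _ _) (le_trans (le_max_left _ _) (le_trans (le_max_right _ _) hβ))
  have hβ₃ : β₃ ≤ β := le_trans (le_max_left _ _) (le_trans (le_max_right _ _) (le_trans (le_max_right _ _) hβ))
  have hβr : βr ≤ β := le_trans (le_max_right _ _) (le_trans (le_max_right _ _) (le_trans (le_max_right _ _) hβ))
  have hα : 0 < a β := ha₀ β
  have hsmall := Ha β hβa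
  have h4 : a β ≤ 1 / 4 := hsmall.trans (min_le_left _ _)
  have hℓ' : a β ≤ ((2 * (σ + κ) + 5) - 2 * (σ + κ)) / 5 := hsmall.trans (min_le_right _ _)
  have hρ' : a β ≤ ((σ + κ + 2 * a β) - σ - κ) / 2 := by linarith
  obtain ⟨hL₀, HRβ⟩ := HR β hβ₅
  obtain ⟨-, -, hLL, hNL, -, hdep⟩ := scales hα hσ hκ h4 hρ' hℓ' hL (RP := ⌈(σ + κ) / a β⌉₊ + 1) rfl
  obtain ⟨-, -, hLL₀, hNL₀, -, -⟩ := scales hα hσ hκ h4 hρ' hℓ' hL₀ (RP := ⌈(σ + κ) / a β⌉₊ + 1) rfl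
  rw [← hRP β] at hLL hLL₀ hdep
  set N := ⌈σ / a β⌉₊ with hN
  have hf0 : ∀ x, x ∉ box 4 N → f (a β • siteToE x) = 0 := fun x hx => apply_smul_siteToE_eq_zero hα hfσ hx
  have hg0 : ∀ y, y ∉ box 4 N → g (a β • siteToE y) = 0 := fun y hy => apply_smul_siteToE_eq_zero hα hgσ hy
  have hh0 : ∀ z, z ∉ box 4 N → h (a β • siteToE z) = 0 := fun z hz => apply_smul_siteToE_eq_zero hα hhσ hz
  have htriple : ∀ x ∈ box 4 N, ∀ y ∈ box 4 N, ∀ z ∈ box 4 N,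
      |torusK3 G r β L x y z - torusK3 G r β (L₀ β) x y z| ≤
      2 * (((C₁ * (a β / κ) ^ 4 + 2 * M * δ β) *
                (C₂ * (a β / κ) ^ 4 / (1 + ‖siteToE (z - y)‖) ^ 4 + 2 * (2 * M * M) * δ β)
            + (C₁ * (a β / κ) ^ 4 + 2 * M * δ β) *
                (C₂ * (a β / κ) ^ 4 / (1 + ‖siteToE (z - x)‖) ^ 4 + 2 * (2 * M * M) * δ β)
            + (C₁ * (a β / κ) ^ 4 + 2 * M * δ β) *
                (C₂ * (a β / κ) ^ 4 / (1 + ‖siteToE (y - x)‖) ^ 4 + 2 * (2 * M * M) * δ β)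
            + (C₁ * (a β / κ) ^ 4 + 2 * M * δ β) * (C₁ * (a β / κ) ^ 4 + 2 * M * δ β) *
                (C₁ * (a β / κ) ^ 4 + 2 * M * δ β))
          + (4 * (M * (2 * M * M) + M * (2 * M * M) + M * (2 * M * M)) + 8 * M * M * M) * δ β)
        + (C₃ * (a β / κ) ^ 4 / (1 + min (min ‖siteToE (y - x)‖ ‖siteToE (z - y)‖) ‖siteToE (z - x)‖) ^ 8
            + 2 * (6 * (M * M * M)) * (δ β + δ β)) :=
    fun x hx y hy z hz => triple_transfer_torus_tempered G r β hC₁ hC₂ hC₃ hκ hα hM hLL hLL₀ (hGood β) (Hr β hβr L hL)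
      (Hr β hβr (L₀ β) hL₀) (H1 β hβ₁) (H2 β hβ₂) (H3 β hβ₃) (hdep x hx) (hdep y hy) (hdep z hz)
  have eQ : ∀ K : ℕ, N ≤ K → Q3 G r β K (a β) f g h = ∑ x ∈ box 4 N, ∑ y ∈ box 4 N, ∑ z ∈ box 4 N,
      f (a β • siteToE x) * g (a β • siteToE y) * h (a β • siteToE z) * torusK3 G r β K x y z := fun K hK => by
    unfold Q3
    exact sum_box₃_eq hK _ (fun x hx y z => by rw [hf0 x hx]; ring) (fun y hy x z => by rw [hg0 y hy]; ring)
      (fun z hz x y => by rw [hh0 z hz]; ring)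
  have eM := sum_box₃_eq hNL₀ (fun x y z => |f (a β • siteToE x)| * |g (a β • siteToE y)| * |h (a β • siteToE z)| *
      (2 * (((C₁ * (a β / κ) ^ 4 + 2 * M * δ β) *
                (C₂ * (a β / κ) ^ 4 / (1 + ‖siteToE (z - y)‖) ^ 4 + 2 * (2 * M * M) * δ β)
            + (C₁ * (a β / κ) ^ 4 + 2 * M * δ β) *
                (C₂ * (a β / κ) ^ 4 / (1 + ‖siteToE (z - x)‖) ^ 4 + 2 * (2 * M * M) * δ β)
            + (C₁ * (a β / κ) ^ 4 + 2 * M * δ β) *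
                (C₂ * (a β / κ) ^ 4 / (1 + ‖siteToE (y - x)‖) ^ 4 + 2 * (2 * M * M) * δ β)
            + (C₁ * (a β / κ) ^ 4 + 2 * M * δ β) * (C₁ * (a β / κ) ^ 4 + 2 * M * δ β) *
                (C₁ * (a β / κ) ^ 4 + 2 * M * δ β))
          + (4 * (M * (2 * M * M) + M * (2 * M * M) + M * (2 * M * M)) + 8 * M * M * M) * δ β)
        + (C₃ * (a β / κ) ^ 4 / (1 + min (min ‖siteToE (y - x)‖ ‖siteToE (z - y)‖) ‖siteToE (z - x)‖) ^ 8
            + 2 * (6 * (M * M * M)) * (δ β + δ β))))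
    (fun x hx y z => by rw [hf0 x hx, abs_zero]; ring)
    (fun y hy x z => by rw [hg0 y hy, abs_zero]; ring) (fun z hz x y => by rw [hh0 z hz, abs_zero]; ring)
  have hsum := abs_sum₃_sub_sum₃_le (box 4 N) (fun x => f (a β • siteToE x)) (fun y => g (a β • siteToE y))
    (fun z => h (a β • siteToE z)) (fun x y z => torusK3 G r β L x y z)
    (fun x y z => torusK3 G r β (L₀ β) x y z) _ htriple
  rw [eQ (L₀ β) hNL₀, eM] at HRβ
  rw [eQ L hNL]
  have tri := abs_sub_abs_le_abs_sub
    (∑ x ∈ box 4 N, ∑ y ∈ box 4 N, ∑ z ∈ box 4 N,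
      f (a β • siteToE x) * g (a β • siteToE y) * h (a β • siteToE z) * torusK3 G r β (L₀ β) x y z)
    (∑ x ∈ box 4 N, ∑ y ∈ box 4 N, ∑ z ∈ box 4 N,
      f (a β • siteToE x) * g (a β • siteToE y) * h (a β • siteToE z) * torusK3 G r β L x y z)
  rw [abs_sub_comm] at hsum
  linarith [hsum, HRβ, tri]

/-- **Conjunct 3 of `stub_floorsEngine` in TEMPERED currency** (module docstring): the same hypotheses with the three
test functions pairwise disjoint and supported in the ball of radius `σ`, `ε > 0` ⇒ three compactly supported,
pairwise-disjoint witnesses with `|Q3| ≥ ε` on every large torus at every large coupling. [folklore] -/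
theorem threePointConjunct_of_torusTempered (a : ℝ → ℝ) (ha₀ : ∀ β, 0 < a β) (ha : Tendsto a atTop (𝓝 0))
    {C₁ C₂ C₃ σ κ M : ℝ} (hC₁ : 0 ≤ C₁) (hC₂ : 0 ≤ C₂) (hC₃ : 0 ≤ C₃) (hσ : 0 < σ) (hκ : 0 < κ)
    (hM : ∀ (x : Fin 4 → ℤ) (U : LGConfig 4 G), |dens G r x U| ≤ M)
    (RP : ℝ → ℕ) (hRP : ∀ β, RP β = ⌈(σ + κ) / a β⌉₊ + 1)
    (Good : ℝ → Set (LGConfig 4 G)) (hGood : ∀ β, MeasurableSet (Good β)) (δ : ℝ → ℝ)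
    (hE1 : ∃ β₁ : ℝ, ∀ β : ℝ, β₁ ≤ β → ∀ ζ ∈ Good β, ∀ ζ' ∈ Good β, ∀ x : Fin 4 → ℤ,
      1 ≤ depth (fun _ => -(RP β : ℤ)) (2 * RP β + 1) x →
        |kerE G r β (fun _ => -(RP β : ℤ)) (2 * RP β + 1) ζ (dens G r x) -
          kerE G r β (fun _ => -(RP β : ℤ)) (2 * RP β + 1) ζ' (dens G r x)| ≤
          C₁ / (depth (fun _ => -(RP β : ℤ)) (2 * RP β + 1) x : ℝ) ^ 4)
    (hE2 : ∃ β₂ : ℝ, ∀ β : ℝ, β₂ ≤ β → ∀ ζ ∈ Good β, ∀ ζ' ∈ Good β, ∀ x y : Fin 4 → ℤ,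
      1 ≤ depth (fun _ => -(RP β : ℤ)) (2 * RP β + 1) x → 1 ≤ depth (fun _ => -(RP β : ℤ)) (2 * RP β + 1) y →
        |kerCov G r β (fun _ => -(RP β : ℤ)) (2 * RP β + 1) ζ (dens G r x) (dens G r y) -
          kerCov G r β (fun _ => -(RP β : ℤ)) (2 * RP β + 1) ζ' (dens G r x) (dens G r y)| ≤
          C₂ / ((min (depth (fun _ => -(RP β : ℤ)) (2 * RP β + 1) x)
            (depth (fun _ => -(RP β : ℤ)) (2 * RP β + 1) y) : ℕ) : ℝ) ^ 4 / (1 + ‖siteToE (y - x)‖) ^ 4)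
    (hE3 : ∃ β₃ : ℝ, ∀ β : ℝ, β₃ ≤ β → ∀ ζ ∈ Good β, ∀ ζ' ∈ Good β, ∀ x y z : Fin 4 → ℤ,
      1 ≤ depth (fun _ => -(RP β : ℤ)) (2 * RP β + 1) x → 1 ≤ depth (fun _ => -(RP β : ℤ)) (2 * RP β + 1) y →
      1 ≤ depth (fun _ => -(RP β : ℤ)) (2 * RP β + 1) z →
        |kerK3 G r β (fun _ => -(RP β : ℤ)) (2 * RP β + 1) ζ x y z -
          kerK3 G r β (fun _ => -(RP β : ℤ)) (2 * RP β + 1) ζ' x y z| ≤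
          C₃ / ((min (min (depth (fun _ => -(RP β : ℤ)) (2 * RP β + 1) x)
            (depth (fun _ => -(RP β : ℤ)) (2 * RP β + 1) y)) (depth (fun _ => -(RP β : ℤ)) (2 * RP β + 1) z) : ℕ) : ℝ) ^ 4 /
            (1 + min (min ‖siteToE (y - x)‖ ‖siteToE (z - y)‖) ‖siteToE (z - x)‖) ^ 8)
    (hrare : ∃ βr : ℝ, ∀ β : ℝ, βr ≤ β → ∀ L : ℕ, σ + κ + 1 ≤ a β * L →
      (wilsonMeasure (d := 4) (L := 2 * L + 1) r.ρ β).real ((torusLift (2 * L + 1)) ⁻¹' Good β)ᶜ ≤ δ β)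
    (hR3 : ∃ (f g h : 𝓢(EuclideanSpace ℝ (Fin 4), ℝ)) (ε β₅ : ℝ) (L₀ : ℝ → ℕ),
      Disjoint (tsupport (f : EuclideanSpace ℝ (Fin 4) → ℝ)) (tsupport (g : EuclideanSpace ℝ (Fin 4) → ℝ)) ∧
      Disjoint (tsupport (g : EuclideanSpace ℝ (Fin 4) → ℝ)) (tsupport (h : EuclideanSpace ℝ (Fin 4) → ℝ)) ∧
      Disjoint (tsupport (f : EuclideanSpace ℝ (Fin 4) → ℝ)) (tsupport (h : EuclideanSpace ℝ (Fin 4) → ℝ)) ∧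
      tsupport (f : EuclideanSpace ℝ (Fin 4) → ℝ) ⊆ Metric.closedBall 0 σ ∧
      tsupport (g : EuclideanSpace ℝ (Fin 4) → ℝ) ⊆ Metric.closedBall 0 σ ∧
      tsupport (h : EuclideanSpace ℝ (Fin 4) → ℝ) ⊆ Metric.closedBall 0 σ ∧ 0 < ε ∧
      ∀ β : ℝ, β₅ ≤ β → σ + κ + 1 ≤ a β * L₀ β ∧
        ε + ∑ x ∈ box 4 (L₀ β), ∑ y ∈ box 4 (L₀ β), ∑ z ∈ box 4 (L₀ β),
            |f (a β • siteToE x)| * |g (a β • siteToE y)| * |h (a β • siteToE z)| *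
              (2 * (((C₁ * (a β / κ) ^ 4 + 2 * M * δ β) *
                        (C₂ * (a β / κ) ^ 4 / (1 + ‖siteToE (z - y)‖) ^ 4 + 2 * (2 * M * M) * δ β)
                    + (C₁ * (a β / κ) ^ 4 + 2 * M * δ β) *
                        (C₂ * (a β / κ) ^ 4 / (1 + ‖siteToE (z - x)‖) ^ 4 + 2 * (2 * M * M) * δ β)
                    + (C₁ * (a β / κ) ^ 4 + 2 * M * δ β) *
                        (C₂ * (a β / κ) ^ 4 / (1 + ‖siteToE (y - x)‖) ^ 4 + 2 * (2 * M * M) * δ β)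
                    + (C₁ * (a β / κ) ^ 4 + 2 * M * δ β) * (C₁ * (a β / κ) ^ 4 + 2 * M * δ β) *
                        (C₁ * (a β / κ) ^ 4 + 2 * M * δ β))
                  + (4 * (M * (2 * M * M) + M * (2 * M * M) + M * (2 * M * M)) + 8 * M * M * M) * δ β)
                + (C₃ * (a β / κ) ^ 4 / (1 + min (min ‖siteToE (y - x)‖ ‖siteToE (z - y)‖) ‖siteToE (z - x)‖) ^ 8
                    + 2 * (6 * (M * M * M)) * (δ β + δ β))) ≤
          |Q3 G r β (L₀ β) (a β) f g h|) :
    ∃ (f g h : 𝓢(EuclideanSpace ℝ (Fin 4), ℝ)) (ε β₅ Λ₅ : ℝ),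
      HasCompactSupport (f : EuclideanSpace ℝ (Fin 4) → ℝ) ∧
      HasCompactSupport (g : EuclideanSpace ℝ (Fin 4) → ℝ) ∧
      HasCompactSupport (h : EuclideanSpace ℝ (Fin 4) → ℝ) ∧
      Disjoint (tsupport (f : EuclideanSpace ℝ (Fin 4) → ℝ)) (tsupport (g : EuclideanSpace ℝ (Fin 4) → ℝ)) ∧
      Disjoint (tsupport (g : EuclideanSpace ℝ (Fin 4) → ℝ)) (tsupport (h : EuclideanSpace ℝ (Fin 4) → ℝ)) ∧
      Disjoint (tsupport (f : EuclideanSpace ℝ (Fin 4) → ℝ)) (tsupport (h : EuclideanSpace ℝ (Fin 4) → ℝ)) ∧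
      0 < ε ∧ ∀ β : ℝ, β₅ ≤ β → ∀ L : ℕ, Λ₅ ≤ a β * L → ε ≤ |Q3 G r β L (a β) f g h| := by
  obtain ⟨f, g, h, ε, β₅, L₀, hfg, hgh, hfh, hfσ, hgσ, hhσ, hε, HR⟩ := hR3
  obtain ⟨β₇, H⟩ := q3_floor_of_torusReference_tempered G r a ha₀ ha hC₁ hC₂ hC₃ hσ hκ hM RP hRP Good hGood δ hE1 hE2
    hE3 hrare f g h ε β₅ L₀ hfσ hgσ hhσ HR
  exact ⟨f, g, h, ε, β₇, σ + κ + 1,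
    (isCompact_closedBall (0 : EuclideanSpace ℝ (Fin 4)) σ).of_isClosed_subset (isClosed_tsupport _) hfσ,
    (isCompact_closedBall (0 : EuclideanSpace ℝ (Fin 4)) σ).of_isClosed_subset (isClosed_tsupport _) hgσ,
    (isCompact_closedBall (0 : EuclideanSpace ℝ (Fin 4)) σ).of_isClosed_subset (isClosed_tsupport _) hhσ,
    hfg, hgh, hfh, hε, H⟩

end Torus

end Summit.QuantumFields.YangMills.Cruxes.NT.Reference

end
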